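import Mathlib
import HarnessLib
import Literature.MathematicalPhysics.StatisticalMechanics.WeightDataOfFRD
import Literature.MathematicalPhysics.StatisticalMechanics.WeightTowerFactorisation
import Literature.MathematicalPhysics.StatisticalMechanics.WeightTowerStrong
import Literature.MathematicalPhysics.StatisticalMechanics.TorusNeighbourhoods

/-!
# The geometric hypotheses of the weight tower for the data of a finite-range decomposition
# (Adams–Buchholz–Kotecký–Müller, Lemma 7.5 (iii),(iv), Lemma 7.6; Theorem 7.1 (w1), (w3)–(w6))

`WeightDataOfFRD.lean` builds the weight data of [ABKM19] (7.2)–(7.5) from a finite-range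
decomposition with ABSTRACT indicator weights `χ_k^X` and enlargement `X ↦ X*`, and proves
`WeightData.Dominated` for it.  This file fixes the geometry on the torus `(ℤ/M)^d` and discharges
the remaining hypothesis structures of the abstract tower (`WeightTower*.lean`):

* the indicator weights are BOX DENSITIES `boxDensity ρ w X (x) = w · #(X ∩ (x + [−ρ,ρ]^d))`
  — for a `k`-polymer `X` and `w = L^{−kd}`, `ρ = 2L^k` this is `≥ 1` exactly on... at least on
  `X⁺ = X + [−L^k,L^k]^d` (every `k`-block `B ⊆ X` near `x` lies inside the box) and `≤ 5^d`, so it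
  plays the role of `χ_X = Σ_{B ∈ 𝓑_k(X)} 1_{B⁺}` of (7.2) (`1_{X⁺} ≤ χ_X ≤ 3^d` there); unlike the
  block count it is ADDITIVE over arbitrary disjoint sets and monotone, which lets all structures
  below hold for arbitrary finite sets with purely metric separation conditions;
* the enlargement is a thickening `enl k X = X + [−r_k, r_k]^d` (`X*` of (6.25)), the locality
  sets are thickenings `X + [−n_k, n_k]^d` (`X^{++}`), and the separation relations are
  `TorusPolymer.Separated` (`dist_∞ ≥ a_k`: "strictly disjoint", `≥ b_k`: "`dist ≥ ¾L^{k+1}`").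

For the resulting data `geomWeightData` we prove, from explicit inequalities between the radii:
`monotone_geomWeightData` (Lemma 7.5 (iv)), `local_geomWeightData` (Lemma 7.5 (iii), with the
stencil of `∇^α`, `|α| ≤ M_ord`), `additive_geomWeightData` (Lemma 7.6 (i), given the finite-range
separation property of the step covariances as a hypothesis), `strongDominated_geomWeightData`
(Lemma 7.6 (ii) (7.59)–(7.60), (7.63), strong forms `g_k · Σ_{α∈s'} L^{2k(|α|−1)}(∇^α)ᵀχ_X∇^α`,
`s' ⊆ s`, `g_k ≤ δ'_k/θ_max`).

Everything is proved; no named fact.  What is NOT here: the concrete radii of [ABKM19] and the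
condition `L ≥ 2^{d+3} + 16R` that makes them admissible, the finite-range input, polymers.

## References
* S. Adams, S. Buchholz, R. Kotecký, S. Müller, arXiv:1910.13564, Ch. 6.2 (6.25), Ch. 7.1 (7.2)–(7.6),
  Lemma 7.5 (iii),(iv), Lemma 7.6 with (7.56)–(7.63) [AdamsBuchholzKoteckyMuller2019].
-/

noncomputable section

namespace Literature.MathematicalPhysics.StatisticalMechanics.GradientRG

open Finset Matrix
open scoped MatrixOrder
open Literature.MathematicalPhysics.StatisticalMechanics.TorusPolymer
  (ball thicken Separated mem_ball mem_thicken thicken_mono thicken_union subset_thicken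
    card_ball_le supNorm_le_iff)
open Literature.MathematicalPhysics.StatisticalMechanics.GradientFRD
  (supNorm mulMat supNorm_add_le natAbs_valMinAbs_le_supNorm)

variable {d M : ℕ} [NeZero M]

/-! ## Box densities (the indicator weights `χ_k^X`) -/

/-- **Box density** `χ(x) = w · #(X ∩ (x + [−ρ,ρ]^d))` — the additive, monotone substitute for the
block count `Σ_{B ∈ 𝓑_k(X)} 1_{B⁺}(x)` of [ABKM19] (7.2) (with `w = L^{−kd}`, `ρ = 2L^k` it is `≥ 1`
on `X⁺` and `≤ 5^d` for `k`-polymers). [cite: AdamsBuchholzKoteckyMuller2019, Ch. 7.1 (7.2)] -/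
def boxDensity (ρ : ℕ) (w : ℝ) (X : Finset (Fin d → ZMod M)) (x : Fin d → ZMod M) : ℝ :=
  w * ((X.filter fun y => y ∈ ball ρ x).card : ℝ)

/-- `χ ≥ 0`. [cite: AdamsBuchholzKoteckyMuller2019, Ch. 7.1 (7.2)] -/
theorem boxDensity_nonneg (ρ : ℕ) {w : ℝ} (hw : 0 ≤ w) (X : Finset (Fin d → ZMod M))
    (x : Fin d → ZMod M) : 0 ≤ boxDensity ρ w X x :=
  mul_nonneg hw (Nat.cast_nonneg _)

/-- **`χ ≤ w(2ρ+1)^d`** (the role of `θ_k ≤ θ_max`, (7.3)). [cite: AdamsBuchholzKoteckyMuller2019, Ch. 7.1 (7.3)] -/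
theorem boxDensity_le (ρ : ℕ) {w : ℝ} (hw : 0 ≤ w) (X : Finset (Fin d → ZMod M))
    (x : Fin d → ZMod M) : boxDensity ρ w X x ≤ w * (2 * ρ + 1) ^ d := by
  refine mul_le_mul_of_nonneg_left ?_ hw
  have h : (X.filter fun y => y ∈ ball ρ x) ⊆ ball ρ x := fun y hy => (Finset.mem_filter.1 hy).2
  exact_mod_cast (Finset.card_le_card h).trans (card_ball_le ρ x)

/-- Monotonicity in `X` (Lemma 7.5 (iv) for `M_k^X`). [cite: AdamsBuchholzKoteckyMuller2019, Lemma 7.5 (iv)] -/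
theorem boxDensity_mono (ρ : ℕ) {w : ℝ} (hw : 0 ≤ w) {X Y : Finset (Fin d → ZMod M)} (h : X ⊆ Y)
    (x : Fin d → ZMod M) : boxDensity ρ w X x ≤ boxDensity ρ w Y x :=
  mul_le_mul_of_nonneg_left (by exact_mod_cast Finset.card_le_card (Finset.filter_subset_filter _ h)) hw

/-- **Additivity over disjoint sets** ((7.59): `χ_{X∪Y} = χ_X + χ_Y`).
[cite: AdamsBuchholzKoteckyMuller2019, Lemma 7.6 (7.59)] -/
theorem boxDensity_union (ρ : ℕ) (w : ℝ) {X Y : Finset (Fin d → ZMod M)} (h : Disjoint X Y) :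
    boxDensity ρ w (X ∪ Y) = boxDensity ρ w X + boxDensity ρ w Y := by
  funext x
  simp only [boxDensity, Pi.add_apply]
  rw [Finset.filter_union, Finset.card_union_of_disjoint (Finset.disjoint_filter_filter h),
    Nat.cast_add, mul_add]

/-- `χ_∅ = 0`. [cite: AdamsBuchholzKoteckyMuller2019, Ch. 7.1 (7.2)] -/
@[simp] theorem boxDensity_empty (ρ : ℕ) (w : ℝ) :
    boxDensity ρ w (∅ : Finset (Fin d → ZMod M)) = 0 := by
  funext x; simp [boxDensity]

/-- **Support**: `χ_X(x) ≠ 0 ⇒ x ∈ X + [−ρ,ρ]^d`. [cite: AdamsBuchholzKoteckyMuller2019, Lemma 7.5 (iii)] -/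
theorem mem_thicken_of_boxDensity_ne_zero {ρ : ℕ} {w : ℝ} {X : Finset (Fin d → ZMod M)}
    {x : Fin d → ZMod M} (h : boxDensity ρ w X x ≠ 0) : x ∈ thicken ρ X := by
  have hne : (X.filter fun y => y ∈ ball ρ x).Nonempty := by
    rw [Finset.nonempty_iff_ne_empty]
    intro he
    rw [boxDensity, he, Finset.card_empty, Nat.cast_zero, mul_zero] at h
    exact h rfl
  exact TorusPolymer.mem_thicken_iff_nonempty.2 hne

/-- **Lower bound**: a subset `B ⊆ X` inside the box contributes `w·#B ≤ χ_X(x)` (with `B` a block: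
`χ_X ≥ 1_{B⁺}`). [cite: AdamsBuchholzKoteckyMuller2019, Lemma 7.6 (7.60)] -/
theorem le_boxDensity_of_subset {ρ : ℕ} {w : ℝ} (hw : 0 ≤ w) {B X : Finset (Fin d → ZMod M)}
    {x : Fin d → ZMod M} (hBX : B ⊆ X) (hBx : B ⊆ ball ρ x) :
    w * (B.card : ℝ) ≤ boxDensity ρ w X x := by
  refine mul_le_mul_of_nonneg_left ?_ hw
  exact_mod_cast Finset.card_le_card fun b hb => Finset.mem_filter.2 ⟨hBX hb, hBx hb⟩

/-! ## Indicators -/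

/-- The indicator `1_X` as a real function. [cite: AdamsBuchholzKoteckyMuller2019, Ch. 7.1 (7.6)] -/
def setInd (X : Finset (Fin d → ZMod M)) (x : Fin d → ZMod M) : ℝ := if x ∈ X then 1 else 0

omit [NeZero M] in
/-- `0 ≤ 1_X`. [cite: AdamsBuchholzKoteckyMuller2019, Ch. 7.1 (7.6)] -/
theorem setInd_nonneg (X : Finset (Fin d → ZMod M)) (x : Fin d → ZMod M) : 0 ≤ setInd X x := by
  unfold setInd; split_ifs <;> norm_num

omit [NeZero M] in
/-- `1_X ≤ 1_Y` for `X ⊆ Y`. [cite: AdamsBuchholzKoteckyMuller2019, Lemma 7.5 (iv)] -/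
theorem setInd_mono {X Y : Finset (Fin d → ZMod M)} (h : X ⊆ Y) (x : Fin d → ZMod M) :
    setInd X x ≤ setInd Y x := by
  unfold setInd
  by_cases hx : x ∈ X
  · rw [if_pos hx, if_pos (h hx)]
  · rw [if_neg hx]; split_ifs <;> norm_num

omit [NeZero M] in
/-- `1_{X∪Y} = 1_X + 1_Y` for disjoint sets. [cite: AdamsBuchholzKoteckyMuller2019, Lemma 7.6 (7.59)] -/
theorem setInd_union {X Y : Finset (Fin d → ZMod M)} (h : Disjoint X Y) :
    setInd (X ∪ Y) = setInd X + setInd Y := by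
  funext x
  simp only [setInd, Pi.add_apply, Finset.mem_union]
  by_cases hx : x ∈ X
  · have hy : x ∉ Y := Finset.disjoint_left.1 h hx
    simp [hx, hy]
  · by_cases hy : x ∈ Y <;> simp [hx, hy]

/-! ## The geometric weight data -/

/-- **The weight data of [ABKM19] (7.5) with box-density indicators and thickenings**:
`frdWeightData` with `χ_k^X = boxDensity ρ_k w_k X` and `enl k X = X + [−r_k, r_k]^d`.
[cite: AdamsBuchholzKoteckyMuller2019, Ch. 7.1 (7.5)] -/
def geomWeightData (L : ℝ) (N : ℕ) (s : Finset (Fin d → ℕ)) (θbar θmax : ℝ) (δ' : ℕ → ℝ)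
    (f : (Fin d → ZMod M) → ℕ → ℂ) (ρ : ℕ → ℕ) (w : ℕ → ℝ) (r : ℕ → ℕ) :
    WeightData (Fin d → ZMod M) :=
  frdWeightData L N s θbar θmax δ' f (fun k X => boxDensity (ρ k) (w k) X) fun k X => thicken (r k) X

section Unfold

variable (L : ℝ) (N : ℕ) (s : Finset (Fin d → ℕ)) (θbar θmax : ℝ) (δ' : ℕ → ℝ)
  (f : (Fin d → ZMod M) → ℕ → ℂ) (ρ : ℕ → ℕ) (w : ℕ → ℝ) (r : ℕ → ℕ)

/-- The seed `A_0^X = ½·Σ_i(∇_i)ᵀ1_X∇_i + (δ'_0/θ_max)·M_0^{χ_X}`. [cite: AdamsBuchholzKoteckyMuller2019, Ch. 7.1 (7.5)] -/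
theorem geomWeightData_seed (X : Finset (Fin d → ZMod M)) :
    (geomWeightData L N s θbar θmax δ' f ρ w r).seed X =
      (1 / 2 : ℝ) • derivForm L 0 (unitIndices d) (setInd X) +
        (δ' 0 / θmax) • derivForm L 0 s (boxDensity (ρ 0) (w 0) X) := rfl

/-- The added forms `(δ'_k/θ_max)·M_k^{χ_X}`. [cite: AdamsBuchholzKoteckyMuller2019, Ch. 7.1 (7.5)] -/
theorem geomWeightData_pert (k : ℕ) (X : Finset (Fin d → ZMod M)) :
    (geomWeightData L N s θbar θmax δ' f ρ w r).pert k X =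
      (δ' k / θmax) • derivForm L k s (boxDensity (ρ k) (w k) X) := rfl

/-- The enlargement `X ↦ X + [−r_k,r_k]^d`. [cite: AdamsBuchholzKoteckyMuller2019, Ch. 6.2 (6.25)] -/
theorem geomWeightData_enl (k : ℕ) (X : Finset (Fin d → ZMod M)) :
    (geomWeightData L N s θbar θmax δ' f ρ w r).enl k X = thicken (r k) X := rfl

/-- The step covariances `mulMat((1+θ̄)c_{k+1})`. [cite: AdamsBuchholzKoteckyMuller2019, Ch. 7.1 (7.5)] -/
theorem geomWeightData_cov (k : ℕ) :
    (geomWeightData L N s θbar θmax δ' f ρ w r).cov k =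
      mulMat fun κ => (1 + θbar) * GradientFRD.cExt N (f κ) (k + 1) := rfl

end Unfold

/-! ## Monotonicity (Lemma 7.5 (iv)) -/

/-- **`WeightData.Monotone`** for the geometric data: `A_0^X`, `M_k^X` monotone in `X`, `X*`
monotone. [cite: AdamsBuchholzKoteckyMuller2019, Lemma 7.5 (iv)] -/
theorem monotone_geomWeightData {L : ℝ} (hL : 0 ≤ L) (N : ℕ) (s : Finset (Fin d → ℕ)) (θbar : ℝ)
    {θmax : ℝ} (hθmax : 0 < θmax) {δ' : ℕ → ℝ} (hδ : ∀ k, 0 ≤ δ' k)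
    (f : (Fin d → ZMod M) → ℕ → ℂ) (ρ : ℕ → ℕ) {w : ℕ → ℝ} (hw : ∀ k, 0 ≤ w k) (r : ℕ → ℕ) :
    (geomWeightData L N s θbar θmax δ' f ρ w r).Monotone where
  seed_mono X Y hXY := by
    rw [geomWeightData_seed, geomWeightData_seed]
    have h1 := (derivForm_mono (M := M) hL 0 (unitIndices d) (setInd_mono hXY)).smul
      (show (0 : ℝ) ≤ 1 / 2 by norm_num)
    have h2 := (derivForm_mono (M := M) hL 0 s fun x => boxDensity_mono (ρ 0) (hw 0) hXY x).smul
      (div_nonneg (hδ 0) hθmax.le)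
    convert h1.add h2 using 1
    rw [smul_sub, smul_sub]; abel
  pert_mono k X Y hXY := by
    rw [geomWeightData_pert, geomWeightData_pert, ← smul_sub]
    exact (derivForm_mono hL k s fun x => boxDensity_mono (ρ k) (hw k) hXY x).smul
      (div_nonneg (hδ k) hθmax.le)
  enl_mono k X Y hXY := by
    rw [geomWeightData_enl, geomWeightData_enl]; exact thicken_mono _ hXY

/-! ## Locality (Lemma 7.5 (iii)) -/

omit [NeZero M] in
/-- A natural number cast to `ℤ/M` has symmetric representative of size at most itself.
[cite: AdamsBuchholzKoteckyMuller2019, Lemma 7.5 (iii) (the stencil x + [0,α] of ∇^α)] -/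
theorem natAbs_valMinAbs_natCast_le [NeZero M] (t : ℕ) : (((t : ZMod M)).valMinAbs).natAbs ≤ t := by
  by_cases ht : t ≤ M / 2
  · rw [ZMod.valMinAbs_natCast_of_le_half ht, Int.natAbs_natCast]
  · exact (ZMod.natAbs_valMinAbs_le _).trans (by omega)

/-- The stencil shift `β` (cast to the torus) has `|β|_∞ ≤ |β|₁`.
[cite: AdamsBuchholzKoteckyMuller2019, Lemma 7.5 (iii)] -/
theorem supNorm_natCast_le (β : Fin d → ℕ) :
    supNorm (fun i => ((β i : ℕ) : ZMod M)) ≤ ∑ i, β i := by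
  rw [supNorm_le_iff]
  intro i
  exact (natAbs_valMinAbs_natCast_le (β i)).trans
    (Finset.single_le_sum (f := β) (fun j _ => Nat.zero_le _) (mem_univ i))

/-- A point of `X + [−ρ,ρ]^d` shifted by a stencil vector of size `≤ m` stays in `X + [−n,n]^d` when
`ρ + m ≤ n`. [cite: AdamsBuchholzKoteckyMuller2019, Lemma 7.5 (iii) (X^+ + [−M,M]^d ⊆ X^{++})] -/
theorem add_mem_thicken_of_mem_thicken {ρ m n : ℕ} (h : ρ + m ≤ n) {X : Finset (Fin d → ZMod M)}
    {x v : Fin d → ZMod M} (hx : x ∈ thicken ρ X) (hv : supNorm v ≤ m) : x + v ∈ thicken n X := by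
  obtain ⟨x₀, hx₀, hxx₀⟩ := mem_thicken.1 hx
  refine mem_thicken.2 ⟨x₀, hx₀, ?_⟩
  have : x + v - x₀ = (x - x₀) + v := by abel
  rw [this]
  exact (supNorm_add_le _ _).trans (by omega)

/-- **`WeightData.Local`** for the geometric data with locality sets `X + [−n_k,n_k]^d`: if every
`α ∈ s` has `1 ≤ |α| ≤ M_ord`, the boxes plus stencils fit (`ρ_k + M_ord ≤ n_k`, `1 ≤ M_ord`) and
`n_k + r_{k+1} ≤ n_{k+1}` ((7.46): `(X*)^{++} ⊆ X^{++}`). [cite: AdamsBuchholzKoteckyMuller2019, Lemma 7.5 (iii)] -/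
theorem local_geomWeightData (L : ℝ) (N : ℕ) {s : Finset (Fin d → ℕ)} {Mord : ℕ} (hMord : 1 ≤ Mord)
    (hs : ∀ α ∈ s, 1 ≤ ∑ i, α i) (hsM : ∀ α ∈ s, ∑ i, α i ≤ Mord) (θbar θmax : ℝ) (δ' : ℕ → ℝ)
    (f : (Fin d → ZMod M) → ℕ → ℂ) {ρ : ℕ → ℕ} (w : ℕ → ℝ) {r n : ℕ → ℕ}
    (hρn : ∀ k, ρ k + Mord ≤ n k) (hnr : ∀ k, n k + r (k + 1) ≤ n (k + 1)) :
    (geomWeightData L N s θbar θmax δ' f ρ w r).Local fun k X => thicken (n k) X where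
  seed_local X := by
    rw [geomWeightData_seed]
    refine (IsGradLocal.smul ?_ _).add (IsGradLocal.smul ?_ _)
    · -- the gradient part: stencil `x + [0, e_i]`, `x ∈ X`
      refine isGradLocal_derivForm L 0 (fun α hα => ?_) fun x hx α hα β hβ => ?_
      · obtain ⟨i, -, rfl⟩ := Finset.mem_image.1 hα
        simp
      · have hxX : x ∈ X := by
          by_contra h; exact hx (by simp [setInd, h])
        obtain ⟨i, -, rfl⟩ := Finset.mem_image.1 hα
        refine add_mem_thicken_of_mem_thicken (ρ := 0) (m := Mord) (by linarith [hρn 0]) ?_ ?_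
        · rw [TorusPolymer.thicken_zero]; exact hxX
        · refine (supNorm_natCast_le β).trans ((Finset.sum_le_sum fun i _ => hβ i).trans ?_)
          rw [Finset.sum_pi_single']; simp [hMord]
    · exact isGradLocal_derivForm L 0 hs fun x hx α hα β hβ =>
        add_mem_thicken_of_mem_thicken (hρn 0) (mem_thicken_of_boxDensity_ne_zero hx)
          ((supNorm_natCast_le β).trans ((Finset.sum_le_sum fun i _ => hβ i).trans (hsM α hα)))
  pert_local k X := by
    rw [geomWeightData_pert]
    exact (isGradLocal_derivForm L k hs fun x hx α hα β hβ =>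
      add_mem_thicken_of_mem_thicken (hρn k) (mem_thicken_of_boxDensity_ne_zero hx)
        ((supNorm_natCast_le β).trans ((Finset.sum_le_sum fun i _ => hβ i).trans (hsM α hα)))).smul _
  nb_enl k X := by
    rw [geomWeightData_enl]
    exact (TorusPolymer.thicken_thicken _ _ X).trans (TorusPolymer.thicken_mono_rad (hnr k) X)

/-! ## Additivity over separated sets (Lemma 7.6 (i)) -/

/-- **`WeightData.Additive`** for the geometric data, with "strictly disjoint at scale `k`" read as
`dist_∞ ≥ a_k` (`a_k ≥ 1`) and "`dist ≥ ¾L^{k+1}`" as `dist_∞ ≥ b_k` (`a_k ≤ b_k`,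
`b_k + 2r_{k+1} ≤ a_{k+1}`: (7.56)), GIVEN the finite-range separation of the locality sets by the
step covariances and their positivity. [cite: AdamsBuchholzKoteckyMuller2019, Lemma 7.6 (i)] -/
theorem additive_geomWeightData (L : ℝ) (N : ℕ) (s : Finset (Fin d → ℕ)) (θbar θmax : ℝ)
    (δ' : ℕ → ℝ) (f : (Fin d → ZMod M) → ℕ → ℂ) (ρ : ℕ → ℕ) (w : ℕ → ℝ) {r n a b : ℕ → ℕ}
    (ha : ∀ k, 1 ≤ a k) (hab : ∀ k, a k ≤ b k) (hb : ∀ k, b k + r (k + 1) + r (k + 1) ≤ a (k + 1))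
    (hcov : ∀ k X Y, Separated (b k) X Y →
      ((geomWeightData L N s θbar θmax δ' f ρ w r).cov k).Separates (thicken (n k) X) (thicken (n k) Y))
    (hcovpsd : ∀ k, ((geomWeightData L N s θbar θmax δ' f ρ w r).cov k).PosSemidef) :
    (geomWeightData L N s θbar θmax δ' f ρ w r).Additive (fun k X => thicken (n k) X)
      (fun k X Y => Separated (a k) X Y) fun k X Y => Separated (b k) X Y where
  seed_add X Y hXY := by
    have hd := TorusPolymer.Separated.disjoint (ha 0) hXY
    rw [geomWeightData_seed, geomWeightData_seed, geomWeightData_seed, setInd_union hd,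
      boxDensity_union _ _ hd, derivForm_add, derivForm_add, smul_add, smul_add]
    abel
  pert_add k X Y hXY := by
    have hd := TorusPolymer.Separated.disjoint (ha k) hXY
    rw [geomWeightData_pert, geomWeightData_pert, geomWeightData_pert, boxDensity_union _ _ hd,
      derivForm_add, smul_add]
  enl_union k X Y _ := by
    simp only [geomWeightData_enl]; exact thicken_union _ X Y
  enl_sep k X Y hXY := by
    simp only [geomWeightData_enl]
    exact (hXY.of_le (hb k)).thicken
  sepF_of_sepM k X Y hXY := hXY.of_le (hab k)
  cov_separates := hcov
  cov_posSemidef := hcovpsd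

/-! ## Strong forms (Lemma 7.6 (ii)) -/

/-- Splitting the index set: `Σ_{α∈s} = Σ_{α∈s'} + Σ_{α∈s∖s'}` for `s' ⊆ s`.
[cite: AdamsBuchholzKoteckyMuller2019, Lemma 7.6 (7.60)] -/
theorem derivForm_eq_add_sdiff (L : ℝ) (k : ℕ) {s s' : Finset (Fin d → ℕ)} (h : s' ⊆ s)
    (χ : (Fin d → ZMod M) → ℝ) :
    derivForm L k s χ = derivForm L k s' χ + derivForm L k (s \ s') χ := by
  unfold derivForm
  rw [← Finset.sum_sdiff h, add_comm]

/-- **`WeightData.StrongDominated`** for the geometric data with the strong forms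
`G_k^X = g_k · Σ_{α∈s'} L^{2k(|α|−1)} (∇^α)ᵀ χ_X ∇^α` (`s' ⊆ s`; in [ABKM19] `s' = {1 ≤ |α| ≤ ⌊d/2⌋+1}`,
`g_k = h_k⁻²`) and disjointness as the relation: additivity (7.59), domination `G_0 ⪯ A_0`,
`G_{k+1} ⪯ δ_{k+1}M_{k+1}` ((7.60), from `g_k ≤ δ'_k/θ_max`) and `X ⊆ X*` ((7.63)).
[cite: AdamsBuchholzKoteckyMuller2019, Lemma 7.6 (ii)] -/
theorem strongDominated_geomWeightData {L : ℝ} (hL : 0 ≤ L) (N : ℕ) {s s' : Finset (Fin d → ℕ)}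
    (hs' : s' ⊆ s) (θbar : ℝ) {θmax : ℝ} (hθmax : 0 < θmax) {δ' : ℕ → ℝ} (hδ : ∀ k, 0 ≤ δ' k)
    (f : (Fin d → ZMod M) → ℕ → ℂ) (ρ : ℕ → ℕ) {w : ℕ → ℝ} (hw : ∀ k, 0 ≤ w k) (r : ℕ → ℕ)
    {g : ℕ → ℝ} (hg : ∀ k, g k ≤ δ' k / θmax) :
    (geomWeightData L N s θbar θmax δ' f ρ w r).StrongDominated
      (fun k X => g k • derivForm L k s' (boxDensity (ρ k) (w k) X)) fun _ X Y => Disjoint X Y where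
  seed_add X Y hXY := by
    rw [geomWeightData_seed, geomWeightData_seed, geomWeightData_seed, setInd_union hXY,
      boxDensity_union _ _ hXY, derivForm_add, derivForm_add, smul_add, smul_add]
    abel
  pert_add k X Y hXY := by
    rw [geomWeightData_pert, geomWeightData_pert, geomWeightData_pert, boxDensity_union _ _ hXY,
      derivForm_add, smul_add]
  strong_isSymm k X := (isSymm_derivForm L k s' _).smul _
  strong_add k X Y hXY := by
    simp only [boxDensity_union _ _ hXY, derivForm_add, smul_add]
  strong_le_seed X := by
    rw [geomWeightData_seed, derivForm_eq_add_sdiff L 0 hs']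
    have hχ : ∀ x, 0 ≤ boxDensity (ρ 0) (w 0) X x := fun x => boxDensity_nonneg _ (hw 0) X x
    have h1 := (posSemidef_derivForm (M := M) hL 0 (unitIndices d) (setInd_nonneg X)).smul
      (show (0 : ℝ) ≤ 1 / 2 by norm_num)
    have h2 := (posSemidef_derivForm hL 0 s' hχ).smul (sub_nonneg.2 (hg 0))
    have h3 := (posSemidef_derivForm hL 0 (s \ s') hχ).smul (div_nonneg (hδ 0) hθmax.le)
    convert (h1.add h2).add h3 using 1
    rw [smul_add, sub_smul]; abel
  strong_le_pert k X := by
    rw [geomWeightData_pert, derivForm_eq_add_sdiff L (k + 1) hs']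
    have hχ : ∀ x, 0 ≤ boxDensity (ρ (k + 1)) (w (k + 1)) X x :=
      fun x => boxDensity_nonneg _ (hw (k + 1)) X x
    have h2 := (posSemidef_derivForm hL (k + 1) s' hχ).smul (sub_nonneg.2 (hg (k + 1)))
    have h3 := (posSemidef_derivForm hL (k + 1) (s \ s') hχ).smul
      (div_nonneg (hδ (k + 1)) hθmax.le)
    convert h2.add h3 using 1
    rw [smul_add, sub_smul]; abel
  subset_enl k X := by rw [geomWeightData_enl]; exact subset_thicken _ X

end Literature.MathematicalPhysics.StatisticalMechanics.GradientRG

end
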